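import Summits.AtomisticToContinuum.HydrodynamicLimit.Theses.RelayRaceLocality
import Literature.MathematicalPhysics.KineticTheory.HardSphereEulerSolutionGluing
import Literature.Analysis.FunctionSpaces.TorusSpaceTime

/-!
# `RestartPrinciple` (stmt-AtomisticToContinuum-12503), line `Sketch`: the bet `stub_restartableHL`
# is implied by the packing-guarded conjunct `G` — the line's reduction has zero logical slack

Negative-side structure of the standing disprover (`Cruxes/RestartPrinciple/Disproof.lean` §5), route
`RelayRaceLocality`, line `Sketch` (lead's skeleton v1, `Cruxes/RestartPrinciple/Lines/Sketch.lean`).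
The skeleton proves the crux from two stubs: `stub_restartableHL` (THE BET: the short-time limit in
restartable currency, prefix `∃ η₀ ∀ profile ∃ σ₀ ∀ σ < σ₀ ∀ M ∃ τ₁`, restart from any `s₀ ∈ [0, T)`)
and the elementary `stub_finiteSize`, via `guardedConjunct_of_stubs : … → G` (restart induction).

* `guardedConjunct_imp_stubRestartableHL : G → stub_restartableHL-statement` — the CONVERSE direction:
  given `G`, take `τ₁ := 1`; the law of large numbers at `s₀ = 0` is among the stub's hypotheses, the
  packing guard on `[0, t]` extends to some `[0, T')`, `T' > t` (max over the compact torus at time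
  `t` + tube lemma `IsSmoothSpaceTimeOn.eventually_norm_sub_lt`; inlined, cf.
  `Negative/ConsequentImpAntecedent.lean`), and `G`
  applied to the restricted solution (`IsHardSphereEulerSolution.restrict`) gives the conclusion; the
  size guards and the LLN on `(0, s₀]` are not used.

Together with the skeleton (`stub_restartableHL ∧ stub_finiteSize → G`, `stub_finiteSize` true) the bet
of line `Sketch` is EQUIVALENT to `G` (the body of the shared open item stmt-AtomisticToContinuum-3093):
the reshaping into restartable currency is faithful bookkeeping with no loss and no gain of strength —
whatever proves the stub proves the guarded hydrodynamic limit outright, and no partial credit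
(e.g. "restart for short macroscopic times only") is available inside this stub as typed.
No new `def`; the stub statement is spelled out verbatim from `Lines/Sketch.lean`.
refuter-cdisprove-stmt-AtomisticToContinuum-12503-0, 2026-08-16.
-/

noncomputable section

namespace Summit.AtomisticToContinuum.HydrodynamicLimit.Theorems.RestartPrincipleNegative

open Literature.MathematicalPhysics.KineticTheory Literature.Analysis.FluidPDE
open Literature.Analysis.FunctionSpaces MeasureTheory Filter Set Topology

/-- The packing-guarded conjunct `G` implies the statement of `stub_restartableHL` (line `Sketch`). -/
theorem guardedConjunct_imp_stubRestartableHL :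
    (∃ η₀ : ℝ, 0 < η₀ ∧ ∀ (a₀ θ₀ : T3 → ℝ) (u₀ : T3 → V3), Continuous a₀ → Continuous θ₀ → Continuous u₀ → (∀ x, 0 < a₀ x) → (∀ x, 0 < θ₀ x) → ∃ σ₀ : ℝ, 0 < σ₀ ∧ ∀ σ : ℝ, 0 < σ → σ < σ₀ → ∀ (T : ℝ) (ρ θ : ℝ → T3 → ℝ) (u : ℝ → T3 → V3), IsHardSphereEulerSolution σ T ρ u θ → (∀ t ∈ Set.Ico 0 T, ∀ x, ρ t x * σ ^ 3 < η₀) → ∀ Φ : (N : ℕ) → HardSphereFlow (Torus.geometry (Fin 3)) (hsDiameter σ N) (N + 1), TendstoHydroFieldsAt (fun N => localGibbsLaw σ a₀ u₀ θ₀ N (Φ N)) Φ ρ u θ 0 → ∀ t ∈ Set.Ico 0 T, TendstoHydroFieldsAt (fun N => localGibbsLaw σ a₀ u₀ θ₀ N (Φ N)) Φ ρ u θ t) →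
    (∃ η₀ : ℝ, 0 < η₀ ∧ ∀ (a₀ θ₀ : T3 → ℝ) (u₀ : T3 → V3), Continuous a₀ → Continuous θ₀ →
      Continuous u₀ → (∀ x, 0 < a₀ x) → (∀ x, 0 < θ₀ x) → ∃ σ₀ : ℝ, 0 < σ₀ ∧ ∀ σ : ℝ, 0 < σ →
      σ < σ₀ → ∀ M : ℝ, 0 < M → ∃ τ₁ : ℝ, 0 < τ₁ ∧ ∀ (T : ℝ) (ρ θ : ℝ → T3 → ℝ) (u : ℝ → T3 → V3),
      IsHardSphereEulerSolution σ T ρ u θ →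
      ∀ Φ : (N : ℕ) → HardSphereFlow (Torus.geometry (Fin 3)) (hsDiameter σ N) (N + 1),
      ∀ s₀ ∈ Set.Ico 0 T,
      (∀ s ∈ Set.Icc 0 s₀,
        TendstoHydroFieldsAt (fun N => localGibbsLaw σ a₀ u₀ θ₀ N (Φ N)) Φ ρ u θ s) →
      ∀ t ∈ Set.Ico s₀ (min T (s₀ + τ₁)),
      (∀ s ∈ Set.Icc 0 t, ∀ x, ρ s x * σ ^ 3 < η₀ ∧ ρ s x ≤ M ∧ θ s x ≤ M ∧ M⁻¹ ≤ θ s x ∧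
        ‖u s x‖ ≤ M ∧ ∀ i j k : Fin 3, |Torus.partialDeriv i (ρ s) x| ≤ M ∧
        ‖Torus.partialDeriv i (u s) x‖ ≤ M ∧ |Torus.partialDeriv i (θ s) x| ≤ M ∧
        |Torus.partialDeriv i (Torus.partialDeriv j (ρ s)) x| ≤ M ∧
        ‖Torus.partialDeriv i (Torus.partialDeriv j (u s)) x‖ ≤ M ∧
        |Torus.partialDeriv i (Torus.partialDeriv j (θ s)) x| ≤ M ∧
        |Torus.partialDeriv i (Torus.partialDeriv j (Torus.partialDeriv k (ρ s))) x| ≤ M ∧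
        ‖Torus.partialDeriv i (Torus.partialDeriv j (Torus.partialDeriv k (u s))) x‖ ≤ M ∧
        |Torus.partialDeriv i (Torus.partialDeriv j (Torus.partialDeriv k (θ s))) x| ≤ M) →
      TendstoHydroFieldsAt (fun N => localGibbsLaw σ a₀ u₀ θ₀ N (Φ N)) Φ ρ u θ t) := by
  rintro ⟨η₀, hη₀, hG⟩
  refine ⟨η₀, hη₀, fun a₀ θ₀ u₀ ha hθ hu ha0 hθ0 => ?_⟩
  obtain ⟨σ₀, hσ₀, hG⟩ := hG a₀ θ₀ u₀ ha hθ hu ha0 hθ0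
  refine ⟨σ₀, hσ₀, fun σ hσ hσσ₀ M _ => ⟨1, one_pos, ?_⟩⟩
  intro T ρ θ u hsol Φ s₀ hs₀ hprev t ht hguard
  have h0 : TendstoHydroFieldsAt (fun N => localGibbsLaw σ a₀ u₀ θ₀ N (Φ N)) Φ ρ u θ 0 :=
    hprev 0 ⟨le_rfl, hs₀.1⟩
  have ht0 : 0 ≤ t := hs₀.1.trans ht.1
  have htT : t ∈ Ico 0 T := ⟨ht0, lt_of_lt_of_le ht.2 (min_le_left _ _)⟩
  have hpk : ∀ s ∈ Icc 0 t, ∀ x, ρ s x * σ ^ 3 < η₀ := fun s hs x => (hguard s hs x).1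
  -- packing extension to `[0, T')`, `T' > t` (inlined)
  have hext : ∃ T' : ℝ, t < T' ∧ T' ≤ T ∧ ∀ s ∈ Ico 0 T', ∀ x, ρ s x * σ ^ 3 < η₀ := by
    have hcont : Continuous (ρ t) := (hsol.smooth_density.isSmooth_slice htT).continuous
    obtain ⟨x₀, -, hx₀⟩ := isCompact_univ.exists_isMaxOn univ_nonempty hcont.continuousOn
    have hσ3 : 0 < σ ^ 3 := pow_pos hσ 3
    have hR : ρ t x₀ < η₀ / σ ^ 3 := by
      rw [lt_div_iff₀ hσ3]
      exact hpk t ⟨ht0, le_rfl⟩ x₀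
    set ε : ℝ := (η₀ / σ ^ 3 - ρ t x₀) / 2 with hε
    have hεpos : 0 < ε := by rw [hε]; linarith
    have hev := hsol.smooth_density.eventually_norm_sub_lt htT hεpos
    obtain ⟨δ, hδ, hδε⟩ := Metric.mem_nhdsWithin_iff.1 hev
    refine ⟨min T (t + δ), lt_min htT.2 (by linarith), min_le_left _ _, fun s hs x => ?_⟩
    by_cases hst : s ≤ t
    · exact hpk s ⟨hs.1, hst⟩ x
    · push Not at hst
      have hsT : s ∈ Ico 0 T := ⟨hs.1, lt_of_lt_of_le hs.2 (min_le_left _ _)⟩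
      have hdist : s ∈ Metric.ball t δ := by
        rw [Metric.mem_ball, Real.dist_eq, abs_of_pos (sub_pos.2 hst)]
        linarith [lt_of_lt_of_le hs.2 (min_le_right _ _)]
      have hmem : s ∈ {s | ∀ x, ‖ρ s x - ρ t x‖ < ε} := hδε ⟨hdist, hsT⟩
      have hnear : ‖ρ s x - ρ t x‖ < ε := hmem x
      have h1 : ρ s x < ρ t x + ε := by
        rw [Real.norm_eq_abs] at hnear
        linarith [(abs_lt.1 hnear).2]
      have h2 : ρ t x ≤ ρ t x₀ := hx₀ (mem_univ x)
      have h3 : ρ t x₀ + ε < η₀ / σ ^ 3 := by rw [hε]; linarith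
      have h4 : ρ s x < η₀ / σ ^ 3 := by linarith
      rwa [lt_div_iff₀ hσ3] at h4
  obtain ⟨T', htT', hT'T, hpack⟩ := hext
  exact hG σ hσ hσσ₀ T' ρ θ u (hsol.restrict hT'T) hpack Φ h0 t ⟨ht0, htT'⟩

end Summit.AtomisticToContinuum.HydrodynamicLimit.Theorems.RestartPrincipleNegative

end
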